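import Literature.Geometry.Manifold.CechSmoothSingular
import Literature.Geometry.Manifold.ChartConvexToSmooth
import Literature.AlgebraicTopology.SingularHomology.CechSingularBridge
import HarnessLib

/-!
# Acyclicity of chart-convex sets for the Čech–smooth-singular double complex

The column hypothesis `hacyc` of `Literature.Geometry.Manifold.cechSmoothSingular_colExact` /
`cechSmoothSingularEquiv` (every concrete smooth `(q+1)`-cocycle of a finite intersection `U_J` is a
smooth coboundary) for the sets that occur in the chart-convex covers of the de Rham theorem files:
chart sets `chartSet I p C` of open convex `C` (Bredon (1993), Lemma V.9.2, smooth case — the cone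
construction of `Literature.Geometry.Manifold.ChartConvexToSmooth`,
`isZero_homology_smoothSubsetCochains_chartSet`) and the empty set.

* `exists_scod_eq_of_isZero_homology` — from `H^{q+1}(Hom(Δ^{sm}(W), N)) = 0` (Mathlib homology of
  the tree's `smoothSubsetCochains`) to the elementwise statement on the concrete cochains
  `SCochainOn` of `CechSmoothSingular` (same bridge as
  `Literature.AlgebraicTopology.SingularHomology.exists_cod_eq_of_isZero_homology`);
* `exists_scod_eq_of_eq_empty`, `exists_scod_eq_chartSet` — the two cases;
* `exists_scod_eq_of_isEmptyOrChartSet` — the packaged hypothesis for a set which is empty or a chart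
  set of a nonempty convex open (the shape of every finite intersection of a chart-convex cover).

No named facts; everything is proved.

## References

* G. E. Bredon, *Topology and Geometry*, GTM 139 (1993), Lemma V.9.2, Thm. V.9.5. [Bredon1993]
* R. Bott, L. W. Tu, *Differential Forms in Algebraic Topology* (1982), Thm. 8.9, Thm. 15.8.
  [BottTu1982Forms]
-/

noncomputable section

-- as in `CechSingular`: chains of the concrete complex are `Finsupp`s up to unfolding
set_option backward.isDefEq.respectTransparency false

open scoped Manifold ContDiff
open CategoryTheory Literature.Algebra.Homology Literature.AlgebraicTopology.SingularHomology
open Literature.Geometry.Kaehler (chartSet)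

universe u v

namespace Literature.Geometry.Manifold

variable {E : Type u} [NormedAddCommGroup E] [NormedSpace ℝ E]
  {H : Type*} [TopologicalSpace H] {I : ModelWithCorners ℝ E H}
  {R : Type v} [CommRing R] {M : Type u} [TopologicalSpace M] [ChartedSpace H M]

/-! ### From vanishing homology to concrete acyclicity -/

/-- **From `H^{q+1}(Hom(Δ^{sm}(W), N)) = 0` to the elementwise acyclicity of the concrete smooth
cochains of `W`** (the hypothesis `hacyc` of `cechSmoothSingular_colExact`): every concrete smooth
`(q+1)`-cocycle of `W` is a smooth coboundary. [folklore] -/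
theorem exists_scod_eq_of_isZero_homology {N : Type (max u v)} [AddCommGroup N] [Module R N]
    (W : Set M) {q : ℕ}
    (h : Limits.IsZero ((smoothSubsetCochains I R (ModuleCat.of R N) M W).homology (q + 1)))
    (ψ : SCochainOn I R N W (q + 1)) (hψ : scod W (q + 1) ψ = 0) :
    ∃ φ : SCochainOn I R N W q, scod W q φ = ψ := by
  rw [isZero_homology_iff] at h
  have hz : (smoothSubsetCochains I R (ModuleCat.of R N) M W).d (q + 1)
      ((ComplexShape.down ℕ).symm.next (q + 1)) (ModuleCat.ofHom ψ) = 0 := by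
    rw [d_next_eq_zero_iff ((ComplexShape.down ℕ).symm.next_eq' rfl), dualObj_d_apply]
    apply ModuleCat.hom_ext
    rw [ModuleCat.hom_comp, ModuleCat.hom_ofHom, ModuleCat.hom_zero]
    exact hψ
  obtain ⟨w, hw⟩ := (exists_d_prev_eq_iff ((ComplexShape.down ℕ).symm.prev_eq' rfl) _).1 (h _ hz)
  refine ⟨w.hom, ?_⟩
  rw [dualObj_d_apply] at hw
  have hw' := congrArg (ModuleCat.Hom.hom (R := R)) hw
  rw [ModuleCat.hom_comp, ModuleCat.hom_ofHom] at hw'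
  exact hw'

/-- The empty subset is acyclic for the concrete smooth cochains (its chain modules vanish: no
simplex has image in `∅`). [folklore] -/
theorem exists_scod_eq_of_eq_empty {N : Type*} [AddCommGroup N] [Module R N] {W : Set M}
    (hW : W = ∅) {q : ℕ} (ψ : SCochainOn I R N W (q + 1)) :
    ∃ φ : SCochainOn I R N W q, scod W q φ = ψ := by
  refine ⟨0, ?_⟩
  rw [map_zero]
  refine (LinearMap.ext fun x ↦ ?_).symm
  have hx : x = 0 := by
    apply Subtype.ext
    have h := (mem_chainsIn_iff R R _).1 x.2.2
    change (x.1 : CChain R M (q + 1)) = 0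
    refine Finsupp.ext fun σ ↦ ?_
    by_contra hσ
    have hne := (SingularSimplex.range_nonempty σ).ne_empty
    exact hne (Set.subset_empty_iff.1 (hW ▸ h σ (Finsupp.mem_support_iff.2 hσ)))
  rw [hx, map_zero, LinearMap.zero_apply]

variable [IsManifold I ∞ M]

/-- **Chart sets of convex opens are acyclic for the concrete smooth cochains in positive degrees**
(Bredon (1993), Lemma V.9.2, smooth case: `isZero_homology_smoothSubsetCochains_chartSet`).
[cite: Bredon1993, Lemma V.9.2] -/
theorem exists_scod_eq_chartSet {N : Type (max u v)} [AddCommGroup N] [Module R N]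
    {p : M} {C : Set E} {c : E} (hCc : Convex ℝ C) (hCT : C ⊆ (extChartAt I p).target) (hc : c ∈ C)
    {q : ℕ} (ψ : SCochainOn I R N (chartSet I p C) (q + 1)) (hψ : scod (chartSet I p C) (q + 1) ψ = 0) :
    ∃ φ : SCochainOn I R N (chartSet I p C) q, scod (chartSet I p C) q φ = ψ :=
  exists_scod_eq_of_isZero_homology (chartSet I p C)
    (isZero_homology_smoothSubsetCochains_chartSet hCc hCT hc (ModuleCat.of R N) q) ψ hψ

/-- **The packaged acyclicity of a set which is empty or a chart set of a convex open**, the shape of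
every finite intersection of a chart-convex cover (`ChartConvexCover.exists_chart`): every concrete
smooth `(q+1)`-cocycle is a smooth coboundary. [cite: Bredon1993, Lemma V.9.2] -/
theorem exists_scod_eq_of_isEmptyOrChartSet {N : Type (max u v)} [AddCommGroup N] [Module R N]
    {W : Set M}
    (hW : W = ∅ ∨ ∃ (p : M) (C : Set E), Convex ℝ C ∧ C ⊆ (extChartAt I p).target ∧
      W = chartSet I p C)
    {q : ℕ} (ψ : SCochainOn I R N W (q + 1)) (hψ : scod W (q + 1) ψ = 0) :
    ∃ φ : SCochainOn I R N W q, scod W q φ = ψ := by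
  rcases hW with hW | ⟨p, C, hCc, hCT, rfl⟩
  · exact exists_scod_eq_of_eq_empty hW ψ
  · rcases C.eq_empty_or_nonempty with hC | ⟨c, hc⟩
    · refine exists_scod_eq_of_eq_empty ?_ ψ
      rw [hC]
      ext x
      simp [chartSet]
    · exact exists_scod_eq_chartSet hCc hCT hc ψ hψ

end Literature.Geometry.Manifold

end
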